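import Summits.NavierStokesRegularity.NavierStokesRegularity.Theorems.ClockStretchingLawClockCeilingUniformClockLaw
import Literature.Analysis.FluidPDE.ESSLocalHolderHolds
import Literature.Analysis.FluidPDE.TypeIAncientMild
import HarnessLib

/-!
# Route ClockStretchingLaw, crux `ClockCeiling` (stmt-NavierStokesRegularity-10570), line `registered` —
# portrait clause H: critical-norm concentration at a Type-I singularity

`stub_localL3BlowupSingular`: a SINGULAR element of the Type-I class `𝒦_C` — `IsTypeIAncientMild C u`
(jointly smooth on `t < 0`, divergence free, KNSS/Oseen mild between all pairs `s < t < 0`,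
`‖u(t,x)‖ ≤ C/√(−t)`) with the scale-invariant energy ledger `A, E ≤ C`, unbounded on every backward
cylinder `(−r², 0) × B_r(0)` — concentrates the critical norm at the singular time:
`limsup_{t → 0⁻} ‖u(t)‖_{L³(B_r)} = +∞` for every `r > 0`, rendered as
`∀ r > 0, ∀ M, ∃ t ∈ (−r², 0), M < ∫_{B_r} ‖u(t)‖³` (Escauriaza–Seregin–Šverák 2003, Thm 1.4, in
contrapositive).

Proof (pure bookkeeping over tree-proved facts).
* UNIT SCALE (`localL3BlowupSingular_unit`). With the mean-free normalisation `p` of its classical slab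
  pressure, `u` is a suitable weak solution in the unit parabolic ball `Q(0,1)` in the class of
  Albritton–Barker Def. 2.1 (`ClockLaw.Birth.classPressure_holds`: distributional equations on `Q(0,1)`,
  `L^∞_t L²_x`, weak gradient in `L²(Q(0,1))`, `p ∈ L^{3/2}(Q(0,1))`). If moreover
  `sup_{−1<t<0} ∫_{B_1} ‖u(t)‖³ ≤ M`, the PROVED local theorem of ESS (`ess_local_holder_holds`, ESS 2003
  Thm 1.4) gives a representative `w`, Hölder continuous on the closure of `Q(0,1/2)`, with `u = w`
  a.e. on `Q(0,1/2)`; `u` is continuous on the open cylinder `Q(0,1/2) ⊆ {t < 0}`, so `u = w` THERE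
  (`Measure.eqOn_open_of_ae_eq`), and `u` is bounded on `Q(0,1/2)` by `max |w|` over the compact closure —
  contradicting singularity at radius `1/2`.
* ALL SCALES by the Navier–Stokes zoom `u_r(s,y) = r u(r²s, r y)`, again a singular element of `𝒦_C`
  (`isTypeIAncientMild_zoom`, `limitSingular_energyLedger_zoom`, `clockLaw_singular_zoom`), and the scale
  invariance of the critical norm, `∫_{B_1} ‖u_r(s)‖³ = ∫_{B_r} ‖u(r²s)‖³` (`lintegral_ball_cube_zoom`).

## References

* L. Escauriaza, G. Seregin, V. Šverák, *`L_{3,∞}`-solutions of Navier–Stokes equations and backward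
  uniqueness*, Russ. Math. Surveys 58 (2003), Thm 1.4. [EscauriazaSereginSverak2003]
* D. Albritton, T. Barker, *On local Type I singularities of the Navier–Stokes equations and Liouville
  theorems*, J. Math. Fluid Mech. 21 (2019) = arXiv:1811.00502, Def. 2.1, Rem. 3.2. [AlbrittonBarker2019]
* G. Koch, N. Nadirashvili, G. Seregin, V. Šverák, Acta Math. 203 (2009) = arXiv:0709.3599, §1 (1.2)
  (scaling of ancient solutions). [KochNadirashviliSereginSverak2009]
-/

noncomputable section

-- the summit and its single sub-problem share the name (CONVENTIONS §1), as in every Theorems file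
set_option linter.dupNamespace false

namespace Summit.NavierStokesRegularity.NavierStokesRegularity.Theorems

open MeasureTheory Set Function Filter Topology Metric
open Literature.Analysis Literature.Analysis.FluidPDE
open scoped NNReal ENNReal

/-- Change of variables `x = r y` (`r > 0`) for the Lebesgue integral over balls of `ℝ³` centred at
the origin: `∫⁻_{B_R} G(r y) dy = r⁻³ ∫⁻_{B_{rR}} G(x) dx` (Mathlib `Measure.map_addHaar_smul`).
[folklore] -/
theorem lintegral_ball_comp_smul_fin3 (G : EuclideanSpace ℝ (Fin 3) → ℝ≥0∞) {r : ℝ} (hr : 0 < r)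
    (R : ℝ) :
    ∫⁻ y in ball (0 : EuclideanSpace ℝ (Fin 3)) R, G (r • y) =
      ENNReal.ofReal ((r ^ 3)⁻¹) * ∫⁻ x in ball (0 : EuclideanSpace ℝ (Fin 3)) (r * R), G x := by
  -- adapted from `lintegral_ball_comp_smul` (Literature/Analysis/FluidPDE/PoincareHomotopyOperatorL2)
  have hr0 : r ≠ 0 := hr.ne'
  have he : MeasurableEmbedding (fun x : EuclideanSpace ℝ (Fin 3) => r • x) :=
    (Homeomorph.smul (isUnit_iff_ne_zero.2 hr0).unit).toMeasurableEquiv.measurableEmbedding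
  have hpre : (fun x : EuclideanSpace ℝ (Fin 3) => r • x) ⁻¹' ball (0 : EuclideanSpace ℝ (Fin 3)) (r * R) =
      ball 0 R := by
    ext x
    simp only [mem_preimage, mem_ball_zero_iff, norm_smul, Real.norm_eq_abs, abs_of_pos hr]
    exact ⟨fun h => lt_of_mul_lt_mul_left h hr.le, fun h => mul_lt_mul_of_pos_left h hr⟩
  have h1 : ∫⁻ y in ball (0 : EuclideanSpace ℝ (Fin 3)) R, G (r • y) =
      ∫⁻ x in ball (0 : EuclideanSpace ℝ (Fin 3)) (r * R), G x
        ∂(Measure.map (fun x : EuclideanSpace ℝ (Fin 3) => r • x) volume) := by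
    rw [he.restrict_map, he.lintegral_map, hpre]
  rw [h1, Measure.map_addHaar_smul volume hr0, Measure.restrict_smul, lintegral_smul_measure,
    finrank_euclideanSpace_fin, smul_eq_mul, abs_of_nonneg (by positivity)]

/-- **Scale invariance of the critical norm on balls**: for the Navier–Stokes zoom
`u_r(s, y) = r u(r² s, r y)` one has `∫_{B_1} ‖u_r(s)‖³ = ∫_{B_r} ‖u(r² s)‖³`
(`r³` from the amplitude against `r⁻³` from `dy = r⁻³ dx`; KNSS 2009, (1.2)).
[cite: KochNadirashviliSereginSverak2009, §1 (1.2) (arXiv:0709.3599 p. 2)] -/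
theorem lintegral_ball_cube_zoom (u : ℝ → EuclideanSpace ℝ (Fin 3) → EuclideanSpace ℝ (Fin 3))
    {r : ℝ} (hr : 0 < r) (s : ℝ) :
    ∫⁻ y in ball (0 : EuclideanSpace ℝ (Fin 3)) 1, ‖(r • stPull (r ^ 2) r 0 0 u) s y‖ₑ ^ 3 =
      ∫⁻ x in ball (0 : EuclideanSpace ℝ (Fin 3)) r, ‖u (r ^ 2 * s) x‖ₑ ^ 3 := by
  have h1 : ∀ y : EuclideanSpace ℝ (Fin 3), ‖(r • stPull (r ^ 2) r 0 0 u) s y‖ₑ ^ 3 =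
      ENNReal.ofReal (r ^ 3) * ‖u (r ^ 2 * s) (r • y)‖ₑ ^ 3 := by
    intro y
    simp only [Pi.smul_apply, stPull_apply, zero_add]
    rw [enorm_smul, mul_pow, Real.enorm_eq_ofReal hr.le, ENNReal.ofReal_pow hr.le]
  simp_rw [h1]
  rw [lintegral_const_mul' _ _ ENNReal.ofReal_ne_top,
    lintegral_ball_comp_smul_fin3 (fun x => ‖u (r ^ 2 * s) x‖ₑ ^ 3) hr 1, mul_one, ← mul_assoc,
    ← ENNReal.ofReal_mul (by positivity), mul_inv_cancel₀ (by positivity), ENNReal.ofReal_one,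
    one_mul]

/-- **Unit scale** (ESS 2003, Thm 1.4, contrapositive, inside `𝒦_C`). A Type-I ancient mild field with
the energy ledger `A, E ≤ C` which is unbounded on every backward cylinder at the origin cannot have
`∫_{B_1} ‖u(t)‖³ ≤ M` for all `t ∈ (−1, 0)`: with the mean-free normalisation of its classical pressure
it is a suitable weak solution in `Q(0,1)` in the class of Albritton–Barker Def. 2.1
(`ClockLaw.Birth.classPressure_holds`), so the local theorem of ESS (`ess_local_holder_holds`) makes it
a.e. equal on `Q(0,1/2)` to a Hölder continuous `w`; by continuity of `u` on the open cylinder the two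
agree everywhere there, and `u` is bounded on `Q(0,1/2)` — contradicting singularity at radius `1/2`.
[cite: EscauriazaSereginSverak2003, Thm. 1.4] -/
theorem localL3BlowupSingular_unit {C : ℝ}
    {u : ℝ → EuclideanSpace ℝ (Fin 3) → EuclideanSpace ℝ (Fin 3)} (hK : IsTypeIAncientMild C u)
    (h5 : ∀ (x₀ : EuclideanSpace ℝ (Fin 3)) (t₀ r : ℝ), t₀ ≤ 0 → 0 < r →
      (∀ t, t₀ - r ^ 2 < t → t < t₀ → r⁻¹ * ∫ x in Metric.ball x₀ r, ‖u t x‖ ^ 2 ≤ C) ∧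
        r⁻¹ * ∫ t in Set.Ioo (t₀ - r ^ 2) t₀, ∫ x in Metric.ball x₀ r, ‖fderiv ℝ (u t) x‖ ^ 2 ≤ C)
    (hsing : ∀ r > 0, ∀ M : ℝ, ∃ t ∈ Set.Ioo (-(r ^ 2)) (0 : ℝ),
      ∃ x ∈ Metric.ball (0 : EuclideanSpace ℝ (Fin 3)) r, M < ‖u t x‖)
    {M : ℝ≥0} (hM : ∀ t ∈ Set.Ioo (-1 : ℝ) 0,
      ∫⁻ x in Metric.ball (0 : EuclideanSpace ℝ (Fin 3)) 1, ‖u t x‖ₑ ^ 3 ≤ M) : False := by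
  -- the Albritton–Barker class in the unit ball, with the mean-free classical pressure
  obtain ⟨K, hKall⟩ := ClockLaw.Birth.classPressure_holds C
  obtain ⟨p, ⟨hswB, ⟨CA, hA⟩, hG, hP⟩, -, -⟩ := hKall u hK h5
  obtain ⟨h32z, h32t, -, h32r⟩ := ClockLaw.Birth.classPressure_threeHalves
  -- the hypotheses of ESS Thm 1.4
  have hA' : ∃ C' : ℝ≥0, ∀ᵐ t ∂(volume.restrict (Ioo (-1 : ℝ) 0)),
      ∫⁻ x in ball (0 : EuclideanSpace ℝ (Fin 3)) 1, ‖u t x‖ₑ ^ 2 ≤ C' :=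
    ⟨CA, by simpa using hA⟩
  have hP' : ∫⁻ z in parabolicCylinder 1 ((0 : ℝ), (0 : EuclideanSpace ℝ (Fin 3))),
      ‖p z.1 z.2‖ₑ ^ (3 / 2 : ℝ) < ∞ := by
    have h := lintegral_rpow_enorm_lt_top_of_eLpNorm_lt_top h32z h32t hP.2
    rw [h32r] at h
    exact h
  have hL3 : ∃ C' : ℝ≥0, ∀ᵐ t ∂(volume.restrict (Ioo (-1 : ℝ) 0)),
      ∫⁻ x in ball (0 : EuclideanSpace ℝ (Fin 3)) 1, ‖u t x‖ₑ ^ 3 ≤ C' :=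
    ⟨M, by
      filter_upwards [ae_restrict_mem measurableSet_Ioo] with t ht
      exact hM t ht⟩
  obtain ⟨w, Cw, α, hα, hw, hae⟩ := ess_local_holder_holds u p hswB.distributional hA' hG hP' hL3
  -- `u = w` everywhere on the open cylinder `Q(0, 1/2)`
  set Q : Set (ℝ × EuclideanSpace ℝ (Fin 3)) :=
    parabolicCylinder (1 / 2) ((0 : ℝ), (0 : EuclideanSpace ℝ (Fin 3))) with hQ
  have hQopen : IsOpen Q := isOpen_parabolicCylinder _ _
  have hQsub : Q ⊆ Iio (0 : ℝ) ×ˢ (univ : Set (EuclideanSpace ℝ (Fin 3))) :=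
    parabolicCylinder_origin_subset_slab (1 / 2)
  have hwc : ContinuousOn w (closure Q) := hw.continuousOn hα
  have huc : ContinuousOn (uncurry u) Q := hK.continuousOn_uncurry.mono hQsub
  have heq : EqOn (uncurry u) w Q :=
    Measure.eqOn_open_of_ae_eq hae hQopen huc (hwc.mono subset_closure)
  -- `w`, hence `u`, is bounded on `Q(0, 1/2)`
  have hcpt : IsCompact (closure Q) :=
    ((Metric.isBounded_Ioo _ _).prod Metric.isBounded_ball).isCompact_closure
  obtain ⟨B, hB⟩ := hcpt.exists_bound_of_continuousOn hwc
  -- contradiction with the singularity at radius `1/2`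
  obtain ⟨t, ht, x, hx, hBlt⟩ := hsing (1 / 2) (by norm_num) B
  have hmem : ((t, x) : ℝ × EuclideanSpace ℝ (Fin 3)) ∈ Q := by
    rw [hQ, mem_parabolicCylinder]
    refine ⟨⟨?_, ht.2⟩, ?_⟩
    · have h1 := ht.1
      dsimp only
      linarith
    · simpa using hx
  have hle : ‖u t x‖ ≤ B := by
    have h := hB (t, x) (subset_closure hmem)
    rwa [← heq hmem] at h
  exact (lt_irrefl B) (hBlt.trans_le hle)

/-- **Portrait clause H — critical-norm concentration at a Type-I singularity**
(Escauriaza–Seregin–Šverák 2003, Thm 1.4, contrapositive, in the Type-I class `𝒦_C`). A Type-I ancient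
mild field `u` (`IsTypeIAncientMild C u`) with the scale-invariant energy ledger `A, E ≤ C` which is
unbounded on every backward cylinder `(−r², 0) × B_r(0)` has `limsup_{t→0⁻} ‖u(t)‖_{L³(B_r)} = ∞` for
every `r > 0`: for all `M` some `t ∈ (−r², 0)` has `M < ∫_{B_r} ‖u(t)‖³`. The unit scale is
`localL3BlowupSingular_unit`; the general scale follows by the Navier–Stokes zoom
`u_r(s,y) = r u(r²s, ry)`, again a singular element of `𝒦_C` (`isTypeIAncientMild_zoom`,
`limitSingular_energyLedger_zoom`, `clockLaw_singular_zoom`), and `∫_{B_1}‖u_r(s)‖³ = ∫_{B_r}‖u(r²s)‖³`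
(`lintegral_ball_cube_zoom`). [cite: EscauriazaSereginSverak2003, Thm. 1.4] -/
theorem stub_localL3BlowupSingular :
    ∀ (C : ℝ) (u : ℝ → EuclideanSpace ℝ (Fin 3) → EuclideanSpace ℝ (Fin 3)),
      Literature.Analysis.FluidPDE.IsTypeIAncientMild C u →
      (∀ (x₀ : EuclideanSpace ℝ (Fin 3)) (t₀ r : ℝ), t₀ ≤ 0 → 0 < r →
        (∀ t, t₀ - r ^ 2 < t → t < t₀ → r⁻¹ * ∫ x in Metric.ball x₀ r, ‖u t x‖ ^ 2 ≤ C) ∧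
          r⁻¹ * ∫ t in Set.Ioo (t₀ - r ^ 2) t₀, ∫ x in Metric.ball x₀ r, ‖fderiv ℝ (u t) x‖ ^ 2 ≤ C) →
      (∀ r > 0, ∀ M : ℝ, ∃ t ∈ Set.Ioo (-(r ^ 2)) (0 : ℝ),
        ∃ x ∈ Metric.ball (0 : EuclideanSpace ℝ (Fin 3)) r, M < ‖u t x‖) →
      ∀ r > 0, ∀ M : NNReal, ∃ t ∈ Set.Ioo (-(r ^ 2)) (0 : ℝ),
        (M : ENNReal) < ∫⁻ x in Metric.ball (0 : EuclideanSpace ℝ (Fin 3)) r, ‖u t x‖ₑ ^ 3 := by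
  intro C u hK h5 hsing r hr M
  by_contra! hcon
  -- `hcon : ∀ t ∈ Ioo (-(r ^ 2)) 0, ∫⁻ x in ball 0 r, ‖u t x‖ₑ ^ 3 ≤ M`; zoom to the unit scale
  have hK' : IsTypeIAncientMild C (r • stPull (r ^ 2) r 0 0 u) := isTypeIAncientMild_zoom hK hr 0
  have h5' := ClockLaw.Birth.limitSingular_energyLedger_zoom hK h5 hr
  have hsing' := clockLaw_singular_zoom hsing hr
  refine localL3BlowupSingular_unit hK' h5' hsing' (M := M) fun s hs => ?_
  rw [lintegral_ball_cube_zoom u hr s]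
  have hr2 : 0 < r ^ 2 := by positivity
  refine hcon (r ^ 2 * s) ⟨?_, mul_neg_of_pos_of_neg hr2 hs.2⟩
  have h1 := hs.1
  nlinarith

end Summit.NavierStokesRegularity.NavierStokesRegularity.Theorems
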